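import Mathlib
import HarnessLib

/-!
# An elementary lattice-point count in a dyadic box

Topic `NumberTheory/DiophantineGeometry`; auxiliary file for the proof of
`Literature.NumberTheory.DiophantineGeometry.bernertEtAl2024_thm_1_2`
(Bernert–Browning–Lichtman–Teräväinen, arXiv:2410.12234 v2, Theorem 1.2), assembled in
`AbcExceptionalSetBoundsProofs`.

The geometry-of-numbers input of the source [cite: Bernert2025, Prop. 2] =
[cite: BernertEtAl2024, Prop. 4.1 (arXiv v2)] is Heath-Brown's bound
`≪ 1 + X₁Y₁Z₁ / max(|a₁|X₁, |a₂|Y₁, |a₃|Z₁)` for the number of primitive solutions of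
`a₁x + a₂y + a₃z = 0` in a box. For positive variables in dyadic boxes (the only case needed) this
reduces to a two-dimensional statement, proved here from scratch with an explicit constant
(`card_lattice_box_coprime_le`):

> for `X, Y, D ≥ 1` and `gcd(a₁, D) = 1`, the number of coprime `(x, y) ∈ [X, 2X) × [Y, 2Y)` with
> `a₁x + a₂y ≡ 0 (mod D)` is at most `1 + 8XY/D`.

Proof: let `u` be a nonzero vector of `Λ = {a₁v₁ + a₂v₂ ≡ 0}` with `|u₁| < X`, `|u₂| < Y`
minimising `N(u) = max(|u₁|Y, |u₂|X)` (differences of two solutions are such vectors). For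
`p ∈ Λ` the determinant `ψ(p) = u₁p₂ − u₂p₁` is divisible by `D` (`dvd_det_of_dvd_of_dvd`), its
values on the box lie in an interval of length `≤ 2N(u)`, so the solutions lie on `≤ 2N(u)/D + 1`
lines `ψ = const`; two solutions on one line differ by a vector parallel to `u`, which by minimality
has `|v₁| ≥ |u₁|`, `|v₂| ≥ |u₂|` (`natAbs_le_of_isMinOn`), so a line carries `≤ XY/N(u) + 1`
solutions; finally a coprime solution off the line `ψ = 0` exists as soon as there are two
solutions, and gives `D ≤ |ψ(p)| < 4N(u)`; also `N(u) < XY`. Multiplying out,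
`#S ≤ (2N/D + 1)(XY/N + 1) ≤ 1 + 8XY/D`.

No definitions are introduced.
-/

open Finset

namespace Literature.NumberTheory.DiophantineGeometry

namespace AbcExceptional

/-! ### One-dimensional counting lemmas -/

/-- Points whose `f`-values lie in an interval of length `L` and are pairwise `≥ m` apart number at
most `L / m + 1`. [folklore] -/
theorem card_le_of_separated {σ : Type*} (T : Finset σ) (f : σ → ℕ) (A L m : ℕ) (hm : 0 < m)
    (hf : ∀ p ∈ T, A ≤ f p ∧ f p < A + L) (hinj : Set.InjOn f T)
    (hsep : ∀ p ∈ T, ∀ p' ∈ T, f p < f p' → f p + m ≤ f p') :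
    #T ≤ L / m + 1 := by
  classical
  calc #T ≤ #(range (L / m + 1)) := ?_
    _ = L / m + 1 := card_range _
  refine card_le_card_of_injOn (fun p => (f p - A) / m) (fun p hp => ?_) (fun p hp p' hp' h => ?_)
  · have := hf p hp
    simp only [coe_range, Set.mem_Iio]
    calc (f p - A) / m ≤ L / m := Nat.div_le_div_right (by omega)
      _ < L / m + 1 := Nat.lt_succ_self _
  · by_contra hne
    have hfne : f p ≠ f p' := fun h' => hne (hinj hp hp' h')
    simp only at h
    rcases lt_or_gt_of_ne hfne with hlt | hlt
    · have h1 := hsep p hp p' hp' hlt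
      have hA := (hf p hp).1
      have : (f p - A) / m + 1 ≤ (f p' - A) / m := by
        calc (f p - A) / m + 1 = (f p - A + m) / m := (Nat.add_div_right _ hm).symm
          _ ≤ (f p' - A) / m := Nat.div_le_div_right (by omega)
      omega
    · have h1 := hsep p' hp' p hp hlt
      have hA := (hf p' hp').1
      have : (f p' - A) / m + 1 ≤ (f p - A) / m := by
        calc (f p' - A) / m + 1 = (f p' - A + m) / m := (Nat.add_div_right _ hm).symm
          _ ≤ (f p - A) / m := Nat.div_le_div_right (by omega)
      omega

/-- A set of integers lying in an interval of length `L` and pairwise congruent modulo `D` has at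
most `L / D + 1` elements. [folklore] -/
theorem card_le_of_dvd_sub (W : Finset ℤ) (D L : ℕ) (hD : 0 < D)
    (hL : ∀ w ∈ W, ∀ w' ∈ W, w' - w ≤ L) (hdvd : ∀ w ∈ W, ∀ w' ∈ W, (D : ℤ) ∣ w' - w) :
    #W ≤ L / D + 1 := by
  classical
  rcases W.eq_empty_or_nonempty with rfl | hne
  · simp
  set w₀ := W.min' hne with hw₀
  have hw₀W : w₀ ∈ W := W.min'_mem hne
  calc #W ≤ #(range (L / D + 1)) := ?_
    _ = L / D + 1 := card_range _
  refine card_le_card_of_injOn (fun w => ((w - w₀) / (D : ℤ)).toNat) (fun w hw => ?_)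
    (fun w hw w' hw' h => ?_)
  · have h1 : w - w₀ ≤ L := hL w₀ hw₀W w hw
    simp only [coe_range, Set.mem_Iio]
    have hDz : (0 : ℤ) < D := by exact_mod_cast hD
    have h2 : (w - w₀) / (D : ℤ) ≤ (L : ℤ) / (D : ℤ) := Int.ediv_le_ediv hDz h1
    have h3 : (L : ℤ) / (D : ℤ) = ((L / D : ℕ) : ℤ) := (Int.natCast_div L D).symm
    have h4 : ((w - w₀) / (D : ℤ)).toNat ≤ L / D := Int.toNat_le.mpr (h2.trans_eq h3)
    exact Nat.lt_succ_of_le h4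
  · simp only at h
    have h0 : w₀ ≤ w := W.min'_le w hw
    have h0' : w₀ ≤ w' := W.min'_le w' hw'
    obtain ⟨a, ha⟩ := hdvd w₀ hw₀W w hw
    obtain ⟨b, hb⟩ := hdvd w₀ hw₀W w' hw'
    have hDz : (D : ℤ) ≠ 0 := by exact_mod_cast hD.ne'
    have hDz' : (0 : ℤ) < D := by exact_mod_cast hD
    rw [ha, hb, Int.mul_ediv_cancel_left _ hDz, Int.mul_ediv_cancel_left _ hDz] at h
    have ha0 : 0 ≤ a := by
      by_contra hneg
      have : (D : ℤ) * a < 0 := mul_neg_of_pos_of_neg hDz' (not_le.mp hneg)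
      omega
    have hb0 : 0 ≤ b := by
      by_contra hneg
      have : (D : ℤ) * b < 0 := mul_neg_of_pos_of_neg hDz' (not_le.mp hneg)
      omega
    have hab : a = b := by omega
    have : w - w₀ = w' - w₀ := by rw [ha, hb, hab]
    omega

/-! ### The lattice `Λ = {v : D ∣ a₁ v₁ + a₂ v₂}`: determinants and the shortest vector -/

/-- For `u, p ∈ Λ` and `gcd(a₁, D) = 1`, the determinant `u₁ p₂ − u₂ p₁` is divisible by `D`
(it is `≡ 0 · a₁⁻¹`). [folklore] -/
theorem dvd_det_of_dvd_of_dvd {a₁ a₂ D : ℤ} (hcop : IsCoprime a₁ D) {u p : ℤ × ℤ}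
    (hu : D ∣ a₁ * u.1 + a₂ * u.2) (hp : D ∣ a₁ * p.1 + a₂ * p.2) :
    D ∣ u.1 * p.2 - u.2 * p.1 := by
  have h : D ∣ a₁ * (u.1 * p.2 - u.2 * p.1) := by
    have : a₁ * (u.1 * p.2 - u.2 * p.1) =
        (a₁ * u.1 + a₂ * u.2) * p.2 - (a₁ * p.1 + a₂ * p.2) * u.2 := by ring
    rw [this]
    exact dvd_sub (dvd_mul_of_dvd_left hu _) (dvd_mul_of_dvd_left hp _)
  exact hcop.symm.dvd_of_dvd_mul_left h

/-- If `u ≠ 0` minimises `N(v) = max(|v₁| Y, |v₂| X)` over a set `V` of vectors, then every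
`v ∈ V` parallel to `u` satisfies `|u₁| ≤ |v₁|` and `|u₂| ≤ |v₂|`. [folklore] -/
theorem natAbs_le_of_isMinOn {X Y : ℕ} (hX : 0 < X) (hY : 0 < Y) (V : Finset (ℤ × ℤ))
    (u : ℤ × ℤ) (hu0 : u ≠ 0)
    (hmin : ∀ v ∈ V, max (u.1.natAbs * Y) (u.2.natAbs * X) ≤ max (v.1.natAbs * Y) (v.2.natAbs * X))
    {v : ℤ × ℤ} (hv : v ∈ V) (hpar : u.1 * v.2 = u.2 * v.1) :
    u.1.natAbs ≤ v.1.natAbs ∧ u.2.natAbs ≤ v.2.natAbs := by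
  have hm := hmin v hv
  have habs : u.1.natAbs * v.2.natAbs = u.2.natAbs * v.1.natAbs := by
    rw [← Int.natAbs_mul, ← Int.natAbs_mul, hpar]
  have hu0' : u.1.natAbs ≠ 0 ∨ u.2.natAbs ≠ 0 := by
    by_contra h
    push Not at h
    exact hu0 (Prod.ext (Int.natAbs_eq_zero.mp h.1) (Int.natAbs_eq_zero.mp h.2))
  by_contra hcon
  rw [not_and_or, not_le, not_le] at hcon
  rcases hcon with h1 | h2
  · -- `|v₁| < |u₁|`
    have hu1 : 0 < u.1.natAbs := by omega
    rcases Nat.eq_zero_or_pos u.2.natAbs with h20 | h2pos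
    · have hv2 : v.2.natAbs = 0 := by
        rw [h20, zero_mul] at habs
        rcases Nat.mul_eq_zero.mp habs with h | h
        · omega
        · exact h
      have : max (v.1.natAbs * Y) (v.2.natAbs * X) < max (u.1.natAbs * Y) (u.2.natAbs * X) := by
        rw [hv2, h20, zero_mul, max_eq_left (Nat.zero_le _), max_eq_left (Nat.zero_le _)]
        exact Nat.mul_lt_mul_of_pos_right h1 hY
      omega
    · have hv2 : v.2.natAbs < u.2.natAbs := by
        have h3 : u.1.natAbs * v.2.natAbs < u.1.natAbs * u.2.natAbs := by
          rw [habs, mul_comm u.1.natAbs]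
          exact Nat.mul_lt_mul_of_pos_left h1 h2pos
        exact Nat.lt_of_mul_lt_mul_left h3
      have : max (v.1.natAbs * Y) (v.2.natAbs * X) < max (u.1.natAbs * Y) (u.2.natAbs * X) :=
        max_lt_max (Nat.mul_lt_mul_of_pos_right h1 hY) (Nat.mul_lt_mul_of_pos_right hv2 hX)
      omega
  · -- `|v₂| < |u₂|`
    have hu2 : 0 < u.2.natAbs := by omega
    rcases Nat.eq_zero_or_pos u.1.natAbs with h10 | h1pos
    · have hv1 : v.1.natAbs = 0 := by
        rw [h10, zero_mul] at habs
        rcases Nat.mul_eq_zero.mp habs.symm with h | h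
        · omega
        · exact h
      have : max (v.1.natAbs * Y) (v.2.natAbs * X) < max (u.1.natAbs * Y) (u.2.natAbs * X) := by
        rw [hv1, h10, zero_mul, max_eq_right (Nat.zero_le _), max_eq_right (Nat.zero_le _)]
        exact Nat.mul_lt_mul_of_pos_right h2 hX
      omega
    · have hv1 : v.1.natAbs < u.1.natAbs := by
        have h3 : u.2.natAbs * v.1.natAbs < u.2.natAbs * u.1.natAbs := by
          rw [← habs, mul_comm u.2.natAbs]
          exact Nat.mul_lt_mul_of_pos_left h2 h1pos
        exact Nat.lt_of_mul_lt_mul_left h3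
      have : max (v.1.natAbs * Y) (v.2.natAbs * X) < max (u.1.natAbs * Y) (u.2.natAbs * X) :=
        max_lt_max (Nat.mul_lt_mul_of_pos_right hv1 hY) (Nat.mul_lt_mul_of_pos_right h2 hX)
      omega

/-! ### The count -/

/-- **Coprime lattice points in a dyadic box.** For `X, Y, D ≥ 1`, integers `a₁, a₂` with
`gcd(a₁, D) = 1`, the number of `(x, y) ∈ [X, 2X) × [Y, 2Y)` with `D ∣ a₁x + a₂y` and
`gcd(x, y) = 1` is at most `1 + 8XY/D`. This is the case of Heath-Brown's lattice-point lemma used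
in [Bernert2025, Prop. 2] and [BernertEtAl2024, Prop. 4.1], proved here by an elementary
shortest-vector argument (see the module docstring). [folklore] -/
theorem card_lattice_box_coprime_le (X Y D : ℕ) (a₁ a₂ : ℤ) (hX : 0 < X) (hY : 0 < Y)
    (hD : 0 < D) (hcop : IsCoprime a₁ D) :
    (#{p ∈ Ico X (2 * X) ×ˢ Ico Y (2 * Y) |
        (D : ℤ) ∣ a₁ * p.1 + a₂ * p.2 ∧ Nat.Coprime p.1 p.2} : ℝ) ≤ 1 + 8 * X * Y / D := by
  classical
  set S := {p ∈ Ico X (2 * X) ×ˢ Ico Y (2 * Y) |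
      (D : ℤ) ∣ a₁ * p.1 + a₂ * p.2 ∧ Nat.Coprime p.1 p.2} with hS_def
  have hpos : (0 : ℝ) ≤ 8 * X * Y / D := by positivity
  have memS : ∀ p ∈ S, (X ≤ p.1 ∧ p.1 < 2 * X) ∧ (Y ≤ p.2 ∧ p.2 < 2 * Y) ∧
      (D : ℤ) ∣ a₁ * p.1 + a₂ * p.2 ∧ Nat.Coprime p.1 p.2 := by
    intro p hp
    simp only [hS_def, mem_filter, mem_product, mem_Ico] at hp
    exact ⟨hp.1.1, hp.1.2, hp.2.1, hp.2.2⟩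
  by_cases hS1 : #S ≤ 1
  · calc (#S : ℝ) ≤ 1 := by exact_mod_cast hS1
      _ ≤ 1 + 8 * X * Y / D := le_add_of_nonneg_right hpos
  obtain ⟨q, hq, q', hq', hqq⟩ := one_lt_card.mp (not_le.mp hS1)
  -- the finite set of short nonzero vectors of the lattice
  set V : Finset (ℤ × ℤ) := {v ∈ Ioo (-(X : ℤ)) X ×ˢ Ioo (-(Y : ℤ)) Y |
      v ≠ 0 ∧ (D : ℤ) ∣ a₁ * v.1 + a₂ * v.2} with hV_def
  have memV : ∀ v, v ∈ V ↔ (-(X : ℤ) < v.1 ∧ v.1 < X) ∧ (-(Y : ℤ) < v.2 ∧ v.2 < Y) ∧ v ≠ 0 ∧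
      (D : ℤ) ∣ a₁ * v.1 + a₂ * v.2 := by
    intro v
    simp only [hV_def, mem_filter, mem_product, mem_Ioo, and_assoc]
  have diffV : ∀ p ∈ S, ∀ p' ∈ S, p ≠ p' → ((p.1 : ℤ) - p'.1, (p.2 : ℤ) - p'.2) ∈ V := by
    intro p hp p' hp' hne
    obtain ⟨⟨h1, h2⟩, ⟨h3, h4⟩, hd, -⟩ := memS p hp
    obtain ⟨⟨h1', h2'⟩, ⟨h3', h4'⟩, hd', -⟩ := memS p' hp'
    refine (memV _).mpr ⟨⟨by omega, by omega⟩, ⟨by omega, by omega⟩, ?_, ?_⟩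
    · intro h0
      apply hne
      simp only [Prod.ext_iff, Prod.fst_zero, Prod.snd_zero] at h0
      exact Prod.ext (by omega) (by omega)
    · have : a₁ * ((p.1 : ℤ) - p'.1) + a₂ * ((p.2 : ℤ) - p'.2) =
          (a₁ * p.1 + a₂ * p.2) - (a₁ * p'.1 + a₂ * p'.2) := by ring
      rw [this]
      exact dvd_sub hd hd'
  have hVne : V.Nonempty := ⟨_, diffV q hq q' hq' hqq⟩
  -- a shortest vector `u` for `N(v) = max (|v₁| Y) (|v₂| X)`
  obtain ⟨u, huV, humin⟩ :=
    V.exists_min_image (fun v => max (v.1.natAbs * Y) (v.2.natAbs * X)) hVne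
  obtain ⟨⟨hu1, hu1'⟩, ⟨hu2, hu2'⟩, hu0, hud⟩ := (memV u).mp huV
  set N := max (u.1.natAbs * Y) (u.2.natAbs * X) with hN_def
  have hu0' : u.1.natAbs ≠ 0 ∨ u.2.natAbs ≠ 0 := by
    by_contra h
    push Not at h
    exact hu0 (Prod.ext (Int.natAbs_eq_zero.mp h.1) (Int.natAbs_eq_zero.mp h.2))
  have hN0 : 0 < N := by
    rcases hu0' with h | h
    · exact lt_max_of_lt_left (Nat.mul_pos (Nat.pos_of_ne_zero h) hY)
    · exact lt_max_of_lt_right (Nat.mul_pos (Nat.pos_of_ne_zero h) hX)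
  have hNXY : N < X * Y := by
    have hle := humin _ (diffV q hq q' hq' hqq)
    obtain ⟨⟨h1, h2⟩, ⟨h3, h4⟩, -, -⟩ := memS q hq
    obtain ⟨⟨h1', h2'⟩, ⟨h3', h4'⟩, -, -⟩ := memS q' hq'
    have e1 : ((q.1 : ℤ) - q'.1).natAbs < X := by omega
    have e2 : ((q.2 : ℤ) - q'.2).natAbs < Y := by omega
    calc N ≤ _ := hle
      _ < X * Y := max_lt (by nlinarith) (by nlinarith)
  -- the linear form `ψ(p) = u₁ p₂ - u₂ p₁`, divisible by `D` on `S`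
  set ψ : ℕ × ℕ → ℤ := fun p => u.1 * p.2 - u.2 * p.1 with hψ_def
  have hψD : ∀ p ∈ S, (D : ℤ) ∣ ψ p := fun p hp =>
    dvd_det_of_dvd_of_dvd (p := ((p.1 : ℤ), (p.2 : ℤ))) hcop hud (memS p hp).2.2.1
  -- (1) each line `ψ = k` carries at most `XY/N + 1` points of `S`
  have fibre : ∀ k : ℤ, (#{p ∈ S | ψ p = k} : ℝ) ≤ X * Y / N + 1 := by
    intro k
    set Sk := {p ∈ S | ψ p = k} with hSk_def
    have sep : ∀ p ∈ Sk, ∀ p' ∈ Sk, p ≠ p' →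
        u.1.natAbs ≤ ((p.1 : ℤ) - p'.1).natAbs ∧ u.2.natAbs ≤ ((p.2 : ℤ) - p'.2).natAbs := by
      intro p hp p' hp' hne
      have hpS := (mem_filter.mp hp).1
      have hp'S := (mem_filter.mp hp').1
      refine natAbs_le_of_isMinOn hX hY V u hu0 humin (diffV p hpS p' hp'S hne) ?_
      have e : ψ p = k := (mem_filter.mp hp).2
      have e' : ψ p' = k := (mem_filter.mp hp').2
      simp only [hψ_def] at e e'
      linear_combination e - e'
    rcases le_total (u.2.natAbs * X) (u.1.natAbs * Y) with hcase | hcase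
    · -- `N = |u₁| Y`: project to the first coordinate
      have hNeq : N = u.1.natAbs * Y := max_eq_left hcase
      have hu1pos : 0 < u.1.natAbs := by
        rcases Nat.eq_zero_or_pos u.1.natAbs with h | h
        · rw [hNeq, h, zero_mul] at hN0
          exact absurd hN0 (lt_irrefl 0)
        · exact h
      have hcard : #Sk ≤ X / u.1.natAbs + 1 := by
        refine card_le_of_separated Sk (fun p => p.1) X X u.1.natAbs hu1pos ?_ ?_ ?_
        · intro p hp
          have := (memS p (mem_filter.mp hp).1).1
          omega
        · intro p hp p' hp' h
          by_contra hne
          have := (sep p hp p' hp' hne).1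
          simp only at h
          omega
        · intro p hp p' hp' hlt
          have hne : p ≠ p' := by
            rintro rfl
            exact lt_irrefl _ hlt
          have := (sep p hp p' hp' hne).1
          omega
      have hu1r : (0 : ℝ) < u.1.natAbs := by exact_mod_cast hu1pos
      have hYr : (0 : ℝ) < Y := by exact_mod_cast hY
      calc (#Sk : ℝ) ≤ ((X / u.1.natAbs + 1 : ℕ) : ℝ) := by exact_mod_cast hcard
        _ ≤ (X : ℝ) / u.1.natAbs + 1 := by
            push_cast
            exact add_le_add Nat.cast_div_le le_rfl
        _ = X * Y / N + 1 := by
            rw [hNeq]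
            push_cast
            rw [mul_div_mul_right _ _ hYr.ne']
    · -- `N = |u₂| X`: project to the second coordinate
      have hNeq : N = u.2.natAbs * X := max_eq_right hcase
      have hu2pos : 0 < u.2.natAbs := by
        rcases Nat.eq_zero_or_pos u.2.natAbs with h | h
        · rw [hNeq, h, zero_mul] at hN0
          exact absurd hN0 (lt_irrefl 0)
        · exact h
      have hcard : #Sk ≤ Y / u.2.natAbs + 1 := by
        refine card_le_of_separated Sk (fun p => p.2) Y Y u.2.natAbs hu2pos ?_ ?_ ?_
        · intro p hp
          have := (memS p (mem_filter.mp hp).1).2.1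
          omega
        · intro p hp p' hp' h
          by_contra hne
          have := (sep p hp p' hp' hne).2
          simp only at h
          omega
        · intro p hp p' hp' hlt
          have hne : p ≠ p' := by
            rintro rfl
            exact lt_irrefl _ hlt
          have := (sep p hp p' hp' hne).2
          omega
      have hu2r : (0 : ℝ) < u.2.natAbs := by exact_mod_cast hu2pos
      have hXr : (0 : ℝ) < X := by exact_mod_cast hX
      calc (#Sk : ℝ) ≤ ((Y / u.2.natAbs + 1 : ℕ) : ℝ) := by exact_mod_cast hcard
        _ ≤ (Y : ℝ) / u.2.natAbs + 1 := by
            push_cast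
            exact add_le_add Nat.cast_div_le le_rfl
        _ = X * Y / N + 1 := by
            rw [hNeq]
            push_cast
            rw [mul_comm (X : ℝ) Y, mul_div_mul_right _ _ hXr.ne']
  -- (2) the values of `ψ` on `S` are `≤ 2N/D + 1` in number
  have absle1 : ∀ p ∈ S, ∀ p' ∈ S, |(p'.2 : ℤ) - p.2| ≤ Y ∧ |(p'.1 : ℤ) - p.1| ≤ X := by
    intro p hp p' hp'
    obtain ⟨⟨h1, h2⟩, ⟨h3, h4⟩, -, -⟩ := memS p hp
    obtain ⟨⟨h1', h2'⟩, ⟨h3', h4'⟩, -, -⟩ := memS p' hp'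
    exact ⟨abs_le.mpr ⟨by omega, by omega⟩, abs_le.mpr ⟨by omega, by omega⟩⟩
  have hNle : ((u.1.natAbs * Y : ℕ) : ℤ) ≤ N ∧ ((u.2.natAbs * X : ℕ) : ℤ) ≤ N :=
    ⟨by exact_mod_cast le_max_left _ _, by exact_mod_cast le_max_right _ _⟩
  have lines : #(S.image ψ) ≤ 2 * N / D + 1 := by
    refine card_le_of_dvd_sub (S.image ψ) D (2 * N) hD ?_ ?_
    · intro w hw w' hw'
      obtain ⟨p, hp, rfl⟩ := mem_image.mp hw
      obtain ⟨p', hp', rfl⟩ := mem_image.mp hw'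
      obtain ⟨b2, b1⟩ := absle1 p hp p' hp'
      have e : ψ p' - ψ p = u.1 * ((p'.2 : ℤ) - p.2) - u.2 * ((p'.1 : ℤ) - p.1) := by
        simp only [hψ_def]
        ring
      have t1 : u.1 * ((p'.2 : ℤ) - p.2) ≤ ((u.1.natAbs * Y : ℕ) : ℤ) := by
        calc u.1 * ((p'.2 : ℤ) - p.2) ≤ |u.1 * ((p'.2 : ℤ) - p.2)| := le_abs_self _
          _ = |u.1| * |(p'.2 : ℤ) - p.2| := abs_mul _ _
          _ ≤ |u.1| * Y := mul_le_mul_of_nonneg_left b2 (abs_nonneg _)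
          _ = ((u.1.natAbs * Y : ℕ) : ℤ) := by rw [Nat.cast_mul, Int.natCast_natAbs]
      have t2 : -(u.2 * ((p'.1 : ℤ) - p.1)) ≤ ((u.2.natAbs * X : ℕ) : ℤ) := by
        calc -(u.2 * ((p'.1 : ℤ) - p.1)) ≤ |u.2 * ((p'.1 : ℤ) - p.1)| := neg_le_abs _
          _ = |u.2| * |(p'.1 : ℤ) - p.1| := abs_mul _ _
          _ ≤ |u.2| * X := mul_le_mul_of_nonneg_left b1 (abs_nonneg _)
          _ = ((u.2.natAbs * X : ℕ) : ℤ) := by rw [Nat.cast_mul, Int.natCast_natAbs]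
      rw [e]
      have hN2 : ((2 * N : ℕ) : ℤ) = 2 * (N : ℤ) := by push_cast; ring
      rw [hN2]
      linarith [hNle.1, hNle.2]
    · intro w hw w' hw'
      obtain ⟨p, hp, rfl⟩ := mem_image.mp hw
      obtain ⟨p', hp', rfl⟩ := mem_image.mp hw'
      exact dvd_sub (hψD p' hp') (hψD p hp)
  -- (3) a point of `S` off the line `ψ = 0` (two coprime positive points on it would coincide)
  have offline : ∃ p ∈ S, ψ p ≠ 0 := by
    by_contra hall
    push Not at hall
    apply hqq
    have e : ψ q = 0 := hall q hq
    have e' : ψ q' = 0 := hall q' hq'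
    simp only [hψ_def] at e e'
    obtain ⟨⟨h1, h2⟩, ⟨h3, h4⟩, -, hc⟩ := memS q hq
    obtain ⟨⟨h1', h2'⟩, ⟨h3', h4'⟩, -, hc'⟩ := memS q' hq'
    have hu1ne : u.1 ≠ 0 := by
      intro h0
      rw [h0, zero_mul, zero_sub, neg_eq_zero] at e
      have hq1 : (q.1 : ℤ) ≠ 0 := by exact_mod_cast (show q.1 ≠ 0 by omega)
      exact hu0 (Prod.ext h0 ((mul_eq_zero.mp e).resolve_right hq1))
    have hcross : q.2 * q'.1 = q'.2 * q.1 := by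
      have h5 : u.1 * ((q.2 : ℤ) * q'.1) = u.1 * ((q'.2 : ℤ) * q.1) := by
        linear_combination (q'.1 : ℤ) * e - (q.1 : ℤ) * e'
      exact_mod_cast mul_left_cancel₀ hu1ne h5
    have hd1 : q.1 ∣ q'.1 := by
      have : q.1 ∣ q'.1 * q.2 := ⟨q'.2, by rw [mul_comm, hcross, mul_comm]⟩
      exact hc.dvd_of_dvd_mul_right this
    have hd2 : q'.1 ∣ q.1 := by
      have : q'.1 ∣ q.1 * q'.2 := ⟨q.2, by rw [mul_comm, ← hcross, mul_comm]⟩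
      exact hc'.dvd_of_dvd_mul_right this
    have h11 : q.1 = q'.1 := Nat.dvd_antisymm hd1 hd2
    have h22 : q.2 = q'.2 := by
      rw [h11] at hcross
      exact Nat.eq_of_mul_eq_mul_right (by omega : 0 < q'.1) hcross
    exact Prod.ext h11 h22
  -- hence `D < 4N`
  obtain ⟨p₀, hp₀, hψ₀⟩ := offline
  have hDN : D < 4 * N := by
    have hle : (D : ℤ) ≤ |ψ p₀| := Int.le_of_dvd (abs_pos.mpr hψ₀) ((dvd_abs _ _).mpr (hψD p₀ hp₀))
    obtain ⟨⟨h1, h2⟩, ⟨h3, h4⟩, -, -⟩ := memS p₀ hp₀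
    have b : |ψ p₀| ≤ |u.1| * p₀.2 + |u.2| * p₀.1 := by
      calc |ψ p₀| = |u.1 * p₀.2 - u.2 * p₀.1| := rfl
        _ ≤ |u.1 * p₀.2| + |u.2 * p₀.1| := abs_sub _ _
        _ = |u.1| * p₀.2 + |u.2| * p₀.1 := by
            rw [abs_mul, abs_mul, Nat.abs_cast, Nat.abs_cast]
    have c1 : |u.1| * (p₀.2 : ℤ) ≤ |u.1| * (2 * Y - 1) :=
      mul_le_mul_of_nonneg_left (by omega) (abs_nonneg _)
    have c2 : |u.2| * (p₀.1 : ℤ) ≤ |u.2| * (2 * X - 1) :=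
      mul_le_mul_of_nonneg_left (by omega) (abs_nonneg _)
    have habs1 : |u.1| = (u.1.natAbs : ℤ) := (Int.natCast_natAbs u.1).symm
    have habs2 : |u.2| = (u.2.natAbs : ℤ) := (Int.natCast_natAbs u.2).symm
    have hsum : (1 : ℤ) ≤ u.1.natAbs + u.2.natAbs := by
      rcases hu0' with h | h <;> omega
    rw [habs1] at b c1
    rw [habs2] at b c2
    have hNle1 : (u.1.natAbs : ℤ) * Y ≤ N := by
      have := hNle.1
      rwa [Nat.cast_mul] at this
    have hNle2 : (u.2.natAbs : ℤ) * X ≤ N := by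
      have := hNle.2
      rwa [Nat.cast_mul] at this
    have : (D : ℤ) < 4 * (N : ℤ) := by nlinarith
    exact_mod_cast this
  -- (4) assemble
  have hsum : #S = ∑ k ∈ S.image ψ, #{p ∈ S | ψ p = k} :=
    card_eq_sum_card_fiberwise (fun p hp => mem_image_of_mem ψ hp)
  have hNr : (0 : ℝ) < N := by exact_mod_cast hN0
  have hDr : (0 : ℝ) < D := by exact_mod_cast hD
  have hXYr : (0 : ℝ) < X * Y := by positivity
  calc (#S : ℝ) = ∑ k ∈ S.image ψ, (#{p ∈ S | ψ p = k} : ℝ) := by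
        rw [hsum]
        push_cast
        rfl
    _ ≤ ∑ k ∈ S.image ψ, ((X : ℝ) * Y / N + 1) := sum_le_sum (fun k _ => fibre k)
    _ = #(S.image ψ) * ((X : ℝ) * Y / N + 1) := by rw [sum_const, nsmul_eq_mul]
    _ ≤ (2 * (N : ℝ) / D + 1) * ((X : ℝ) * Y / N + 1) := by
        gcongr
        calc (#(S.image ψ) : ℝ) ≤ ((2 * N / D + 1 : ℕ) : ℝ) := by exact_mod_cast lines
          _ ≤ 2 * (N : ℝ) / D + 1 := by
              have h := (Nat.cast_div_le (m := 2 * N) (n := D) (α := ℝ))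
              push_cast at h ⊢
              exact add_le_add h le_rfl
    _ = 2 * ((X : ℝ) * Y) / D + 2 * (N : ℝ) / D + (X : ℝ) * Y / N + 1 := by
        field_simp
        ring
    _ ≤ 2 * ((X : ℝ) * Y) / D + 2 * ((X : ℝ) * Y) / D + 4 * ((X : ℝ) * Y) / D + 1 := by
        have hN1 : (N : ℝ) ≤ X * Y := by exact_mod_cast hNXY.le
        have hN2 : (X : ℝ) * Y / N ≤ 4 * ((X : ℝ) * Y) / D := by
          rw [div_le_div_iff₀ hNr hDr]
          have : (D : ℝ) ≤ 4 * N := by exact_mod_cast hDN.le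
          nlinarith
        gcongr
    _ = 1 + 8 * X * Y / D := by ring

end AbcExceptional

end Literature.NumberTheory.DiophantineGeometry
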